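import Literature.NumberTheory.EllipticCurves.IsogenyFactorProofs
import Literature.NumberTheory.EllipticCurves.PastenHeightBoundsIsogenyProofs
import Literature.NumberTheory.EllipticCurves.NeronIsogenyScalingHoldsProofs
import Literature.NumberTheory.EllipticCurves.ModularCurveRealPeriodProofs
import Literature.NumberTheory.EllipticCurves.ManinConstantSemistablePrimewise
import Literature.NumberTheory.EllipticCurves.Rank1Residual.PeriodUnitProofs
import Literature.NumberTheory.EllipticCurves.CuspFormLFunctionLevelConductorProofs
import Literature.NumberTheory.EllipticCurves.ModularityVersionApProofs
import Literature.NumberTheory.EllipticCurves.RootNumberAtkinLehnerSemistableProofs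
import Literature.NumberTheory.EllipticCurves.RootNumberTwistProofs
import Literature.NumberTheory.Automorphic.ShimuraCurveRibetTakahashiOptimalModularityProofs
import HarnessLib

/-!
# Skinner–Urban 2014, §3.6.7 / Greenberg–Vatsal 2000, Remark 3.4: at a prime `p` with `E[p]`
# irreducible the Néron period is a `p`-adic unit multiple of the period of the newform — PROVED
# from the Manin constant of the optimal curve (theorems only)

C. Skinner, E. Urban, *The Iwasawa main conjectures for `GL₂`*, Invent. Math. 195 (2014), 1–277
(bib key `SkinnerUrban2014`; held author version `paper:doi-10-1007-s00222-013-0448-1`, whose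
pagination the `[cite:]`s use), §3.6.7, p. 45, ll. 27–30: *"Let `L_E ∈ Λ_ℚ ⊗ ℚ_p` be the usual
`p`-adic `L`-function for `E`. A priori this is a `ℚ_p^×`-multiple of `𝓛_f`, and if `E[p]` is an
irreducible `G_ℚ`-representation, then `L_E` is a `p`-adic unit multiple of `𝓛_f`."* — the period
comparison `Ω_E = u · Ω⁺_f`, `u ∈ ℚ`, `|u|_p = 1`, printed there without proof, and in
R. Greenberg, V. Vatsal, Invent. Math. 142 (2000), §3, Remark 3.4 as *"If `E` does not admit any
`p`-isogenies, so that `E[p]` is irreducible, then it is clear that the Néron periods of any isogenous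
curve differ from those of `E` by a `p`-adic unit"* (combined with the Manin constant of the strong
Weil curve).  HONEST FRAMING (cell `b2b-bsdres`, home `run/shared/lean/b2b/bsd-rank1-residual/`): the
cell deletes COMBINATION-shaped residual classes of analytic-rank `≤ 1` curves from PUBLISHED
theorems only and types the construction-shaped ones; this is not "finishing BSD".  This is a
*proofs* file (theorems only: no definition, no named fact, no `sorry`; D-0026).

## What is proved

The tree carries this comparison as THREE named facts of `ModularCurvePeriodRatio.lean` —
`realPeriodRat_eq_unit_mul_plusPeriod` (good `p ≥ 5`), `…_three` (good `p = 3`),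
`…_of_multiplicative` (multiplicative `p ≥ 5`), each "Size L; no `_holds`", sourced to the
Greenberg–Vatsal remark — consumed (through the inline binder `hϖ`,
`Rank1Residual/PeriodUnitProofs.lean`) by every rank-`0` `p`-part theorem of the cell at an
irreducible prime and by the Kim-type Kurihara-number facts.  Here all three are DERIVED from ONE
named fact with a printed proof, in the lattice form in which the tree vendors it
(`ManinConstantSemistablePrimewise.lean`):

* `mazur_not_dvd_maninConstant_of_odd` — B. Mazur, Invent. Math. 44 (1978), Cor. 4.1: for the
  `X₀(N)`-optimal curve and an ODD prime `p` with `p² ∤ N`, `p ∤ c` (quoted as (MK-1) of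
  K. Česnavičius, Compositio Math. 154 (2018), §1 / arXiv:1604.02165 Thm. 1.2 "(manin-known)":
  "if `ord_p(n) ≤ 1`, then `ord_p(c_π) = 0` … (MK-1) if `p` is odd", and reproved there);

(alternatively, for good `p`, `abbesUllmo_not_dvd_maninConstant_of_not_dvd_level` — A. Abbes,
E. Ullmo, Compositio Math. 103 (1996), Thm. A), everything else being THEOREMS of the tree:
Edixhoven's integrality of the Manin constant (`edixhoven_int_of_neronLattice_eq_smul_periodLattice_holds`),
the optimal datum of a modular curve (`ModularParametrizationData.exists_optimalDatum_of_edixhoven`,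
`nonempty_modularParametrizationData_of_isNewformOf`), the integrality of Néron scalings between
globally minimal models (`integral_neronScaling_of_isGloballyMinimal_holds`), the lattice index of a
`ℚ`-isogeny (`exists_rat_mulLeft_lattice_le_of_isogeny`), the factorisation `ψ = λ ∘ [m]` of an
isogeny killing `E[m]` (`Isogeny.exists_eq_comp_zsmul_of_geomTorsion_le_ker`), the real-lattice
period lemmas of `ModularCurveRealPeriodProofs`, and Atkin–Lehner's `p ∣ N ↔ p ∣ N_E`,
`a_p ≠ 0 ⇒ p² ∤ N`.

* §1 `forall_geomTorsion_apply_eq_zero_of_irreducible_of_dvd_degree`,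
  **`exists_isogeny_not_dvd_degree_of_irreducible`** — over any field `K` with `p ≠ char K`: if
  `E[p]` is irreducible, every `K`-isogeny class member `E'` receives a `K`-isogeny `E → E'` of
  degree prime to `p` (Cauchy's theorem in `ker ψ`, `Γ_K`-stability of `ker ψ ∩ E[p]`, descent
  `ψ = λ ∘ [p]`; Silverman *AEC* III.4.11).
* §2 **`exists_int_mul_minRealPeriod_eq_of_isogeny`** — for a `ℚ`-isogeny `ψ : W → W'` of degree `d`
  between GLOBALLY MINIMAL models with Néron lattices `Λ, Λ'` (least positive real periods
  `Ω₀, Ω₀'`): integers `q ∣ d`, `ab = d` with `qΩ₀ = aΩ₀'` (`ψ` is `z ↦ qz`, `[Λ' : qΛ] = d`,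
  `q, d/q ∈ ℤ` by Néron integrality, `Λ ∩ ℝ = ℤΩ₀`).
* §3 **`exists_dvd_two_mul_realPeriodRat_eq_of_latticeEq`** — for a lattice-optimal datum
  (`Λ_{E₀} = c₀Λ_f`): `m · Ω(E₀) = |c₀| · Ω⁺_f` with `m ∣ 2`.
* §4 **`exists_unit_mul_plusPeriod_of_irreducible`** — `W` globally minimal, `p` odd, `E[p]`
  irreducible, `f` the newform of `W` at level `N`, and `p ∤ c₀` for the lattice-optimal datum at
  level `N`: `Ω(W) = u · Ω⁺_f`, `u = n a |c₀| /(q m n₀) ∈ ℚ`, `‖u‖_p = 1` (`n, n₀, m ∣ 2`,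
  `a, q ∣ d`, `p ∤ d`).
* §5 the named facts: `exists_unit_mul_plusPeriod_of_irreducible_of_mazur` (odd `p`, `p² ∤ N`),
  `…_of_abbesUllmo` (`p ∤ N`); **`realPeriodRat_eq_unit_mul_plusPeriod_of_mazur`**,
  **`realPeriodRat_eq_unit_mul_plusPeriod_three_of_mazur`**,
  **`realPeriodRat_eq_unit_mul_plusPeriod_of_multiplicative_of_mazur`** (and the two `_of_abbesUllmo`
  variants for good `p`), `periodUnit_facts_of_mazur` (the conjunction), and `periodUnit_of_mazur`
  (the cell's inline binder `hϖ` verbatim); with `LFunction_apply_ne_zero_of_hasMultiplicativeReductionAtPrime`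
  (`a_p = ±1`), `not_dvd_level_of_hasGoodReductionAtPrime`,
  `not_sq_dvd_level_of_hasMultiplicativeReductionAtPrime`.

So a consumer holding `(h5 : realPeriodRat_eq_unit_mul_plusPeriod) (h3 : …_three)` or
`(hmult : …_of_multiplicative)` may instead hold `(hM : mazur_not_dvd_maninConstant_of_odd)` and
write `realPeriodRat_eq_unit_mul_plusPeriod_of_mazur hM` etc.; nothing is discharged
unconditionally (Mazur's Cor. 4.1 — Néron models of `J₀(N)` over `ℤ_(p)` — is not proved in the
tree) and no statement of the tree is changed.

## References

* C. Skinner, E. Urban, Invent. Math. 195 (2014), §3.6.7 (author version p. 45). [SkinnerUrban2014]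
* R. Greenberg, V. Vatsal, *On the Iwasawa invariants of elliptic curves*, Invent. Math. 142
  (2000) 17–63, §3, Remark 3.4. [GreenbergVatsal2000]
* B. Mazur, *Rational isogenies of prime degree*, Invent. Math. 44 (1978) 129–162, Cor. 4.1.
  [Mazur1978]
* A. Abbes, E. Ullmo, Compositio Math. 103 (1996) 269–286, Thm. A. [AbbesUllmo1996]
* K. Česnavičius, *The Manin constant in the semistable case*, Compositio Math. 154 (2018)
  1889–1920, Thm. 1.2 and §1 (held: `paper:arxiv-1703.02951` p. 3; arXiv:1604.02165 p. 3,
  "(manin-known) (MK-1)–(MK-4)"). [Cesnavicius2018]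
* B. Edixhoven, *On the Manin constants of modular elliptic curves*, Progr. Math. 89 (1991), Prop. 2
  and §1. [EdixhovenManin1991]
* J. H. Silverman, *The Arithmetic of Elliptic Curves*, 2nd ed., GTM 106 (2009), III.4.11,
  VI.4.1 (b), VI.5.3. [SilvermanAEC2009]
* J. E. Cremona, *Algorithms for modular elliptic curves*, 2nd ed. (1997), §2.8. [CremonaAlgorithms1997]
-/

noncomputable section

open scoped Classical

universe u

namespace Literature.NumberTheory.EllipticCurves.SkinnerUrban2014

open _root_.WeierstrassCurve

/-! ### §1. An isogeny of degree prime to `p` out of a curve with `E[p]` irreducible -/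

section PrimeToP

variable {K : Type u} [Field K] {W W' : WeierstrassCurve K} [W.IsElliptic]

omit [W.IsElliptic] in
/-- **If `E[p]` is irreducible and `p` divides the degree of a `K`-isogeny `ψ : E → E'`, then
`E[p] ⊆ ker ψ`.** By Cauchy's theorem `ker ψ` (of order `deg ψ`) has a point of order `p`, so the
`Γ_K`-stable subgroup `ker ψ ∩ E[p]` of `E[p]` (stable because `ψ` is defined over `K`) is not `0`;
irreducibility makes it all of `E[p]`. (Greenberg–Vatsal 2000, §3, Remark 3.4: "if `E` does not
admit any `p`-isogenies, so that `E[p]` is irreducible …"; Silverman, *AEC*, III.4, Cor. III.4.9: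
`#ker ψ = deg ψ`, Cor. III.4.11.) [cite: GreenbergVatsal2000, §3, Remark 3.4]
[cite: SilvermanAEC2009, Cor. III.4.9 and Cor. III.4.11] -/
theorem forall_geomTorsion_apply_eq_zero_of_irreducible_of_dvd_degree {p : ℕ} [Fact p.Prime]
    (hirr : W.HasIrreducibleModPGaloisRep p) (ψ : Isogeny W W') (hp : p ∣ ψ.degree) :
    ∀ P ∈ geomTorsion W (p : ℤ), ψ P = 0 := by
  -- `H = ker ψ ∩ E[p]`, as a subgroup of `E[p]`
  set H : AddSubgroup (geomTorsion W (p : ℤ)) :=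
    ψ.toAddMonoidHom.ker.comap (geomTorsion W (p : ℤ)).subtype with hH
  have hstab : ∀ σ : Field.absoluteGaloisGroup K, ∀ P ∈ H, σ • P ∈ H := by
    intro σ P hP
    simp only [hH, AddSubgroup.mem_comap, AddMonoidHom.mem_ker, AddSubgroup.coe_subtype,
      Isogeny.coe_toAddMonoidHom] at hP ⊢
    rw [AddSubgroup.torsionBy.coe_smul, ψ.map_smul, hP, smul_zero]
  -- Cauchy: a point of order `p` in `ker ψ`
  obtain ⟨x, hx⟩ := exists_prime_addOrderOf_dvd_card' (G := ψ.toAddMonoidHom.ker) p hp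
  have hxp : (p : ℤ) • ((x : ψ.toAddMonoidHom.ker) : W.geomPoints) = 0 := by
    have h1 : addOrderOf x • x = 0 := addOrderOf_nsmul_eq_zero x
    rw [hx] at h1
    have h2 := congrArg (fun y : ψ.toAddMonoidHom.ker ↦ (y : W.geomPoints)) h1
    simpa [natCast_zsmul] using h2
  have hx0 : ((x : ψ.toAddMonoidHom.ker) : W.geomPoints) ≠ 0 := by
    intro h0
    have : x = 0 := Subtype.ext h0
    rw [this, addOrderOf_zero] at hx
    exact (Fact.out : p.Prime).one_lt.ne hx
  rcases hirr H hstab with hbot | htop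
  · exfalso
    have hmem : (⟨(x : W.geomPoints), (mem_torsionPoints_iff _ _ _).mpr hxp⟩ :
        geomTorsion W (p : ℤ)) ∈ H := by
      simp only [hH, AddSubgroup.mem_comap, AddSubgroup.coe_subtype]
      exact x.2
    rw [hbot, AddSubgroup.mem_bot] at hmem
    exact hx0 (congrArg Subtype.val hmem)
  · intro P hP
    have hmem : (⟨P, hP⟩ : geomTorsion W (p : ℤ)) ∈ H := by rw [htop]; exact AddSubgroup.mem_top _
    rw [hH, AddSubgroup.mem_comap, AddMonoidHom.mem_ker] at hmem
    exact hmem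

/-- **An elliptic curve with `E[p]` irreducible admits a `K`-isogeny of degree prime to `p` onto
every `K`-isogenous curve** (`p ≠ char K`). Descent on the degree: if `p ∣ deg ψ` then
`E[p] ⊆ ker ψ` (`forall_geomTorsion_apply_eq_zero_of_irreducible_of_dvd_degree`), so `ψ = λ ∘ [p]`
(Silverman, *AEC*, Cor. III.4.11; tree `Isogeny.exists_eq_comp_zsmul_of_geomTorsion_le_ker`) with
`deg λ < deg ψ` (`[p] : ker ψ ↠ ker λ` is onto and kills a point of order `p`). This is the isogeny
used in Greenberg–Vatsal 2000, §3, Remark 3.4 ("the Néron periods of any isogenous curve differ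
from those of `E` by a `p`-adic unit"). [cite: GreenbergVatsal2000, §3, Remark 3.4]
[cite: SilvermanAEC2009, Cor. III.4.11] -/
theorem exists_isogeny_not_dvd_degree_of_irreducible {p : ℕ} [Fact p.Prime] (hpK : (p : K) ≠ 0)
    (hirr : W.HasIrreducibleModPGaloisRep p) (h : IsIsogenous W W') :
    ∃ ψ : Isogeny W W', ¬ p ∣ ψ.degree := by
  obtain ⟨ψ₀⟩ := h
  suffices H : ∀ n : ℕ, ∀ ψ : Isogeny W W', ψ.degree = n → ∃ ψ' : Isogeny W W', ¬ p ∣ ψ'.degree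
    from H _ ψ₀ rfl
  intro n
  induction n using Nat.strong_induction_on with
  | _ n ih =>
  intro ψ hn
  by_cases hp : p ∣ ψ.degree
  swap
  · exact ⟨ψ, hp⟩
  have hpP : p.Prime := Fact.out
  have hp0 : (p : ℤ) ≠ 0 := by exact_mod_cast hpP.ne_zero
  have hpK' : ((p : ℤ) : K) ≠ 0 := by rwa [Int.cast_natCast]
  have hker := forall_geomTorsion_apply_eq_zero_of_irreducible_of_dvd_degree hirr ψ hp
  obtain ⟨lam, hlam⟩ := Isogeny.exists_eq_comp_zsmul_of_geomTorsion_le_ker hpK' ψ hker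
  -- `[p] : ker ψ → ker λ` is onto but not injective, so `deg λ < deg ψ`
  have hmap : ∀ x : ψ.toAddMonoidHom.ker, (p : ℤ) • (x : W.geomPoints) ∈ lam.toAddMonoidHom.ker := by
    intro x
    rw [AddMonoidHom.mem_ker, Isogeny.coe_toAddMonoidHom, ← hlam]
    exact x.2
  set f : ψ.toAddMonoidHom.ker → lam.toAddMonoidHom.ker := fun x ↦ ⟨_, hmap x⟩ with hf
  have hsurj : Function.Surjective f := by
    rintro ⟨y, hy⟩
    obtain ⟨Q, hQ⟩ := zsmul_geomPoints_surjective_holds W hp0 y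
    have hQker : Q ∈ ψ.toAddMonoidHom.ker := by
      rw [AddMonoidHom.mem_ker, Isogeny.coe_toAddMonoidHom, hlam Q]
      simp only at hQ
      rw [hQ]
      exact hy
    exact ⟨⟨Q, hQker⟩, Subtype.ext hQ⟩
  obtain ⟨x, hx⟩ := exists_prime_addOrderOf_dvd_card' (G := ψ.toAddMonoidHom.ker) p hp
  have hxp : (p : ℤ) • ((x : ψ.toAddMonoidHom.ker) : W.geomPoints) = 0 := by
    have h1 : addOrderOf x • x = 0 := addOrderOf_nsmul_eq_zero x
    rw [hx] at h1
    have h2 := congrArg (fun y : ψ.toAddMonoidHom.ker ↦ (y : W.geomPoints)) h1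
    simpa [natCast_zsmul] using h2
  have hx0 : x ≠ 0 := by
    intro h0
    rw [h0, addOrderOf_zero] at hx
    exact hpP.one_lt.ne hx
  have hninj : ¬ Function.Injective f := by
    intro hinj
    apply hx0
    apply hinj
    apply Subtype.ext
    simp only [hf, hxp, ZeroMemClass.coe_zero, smul_zero]
  haveI : Fintype ψ.toAddMonoidHom.ker := Fintype.ofFinite _
  haveI : Fintype lam.toAddMonoidHom.ker := Fintype.ofFinite _
  have hlt : lam.degree < ψ.degree := by
    rw [Isogeny.degree, Isogeny.degree, Nat.card_eq_fintype_card, Nat.card_eq_fintype_card]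
    exact Fintype.card_lt_of_surjective_not_injective f hsurj hninj
  exact ih lam.degree (hn ▸ hlt) lam rfl

end PrimeToP

/-! ### §2. The lattice step: Néron lattices of globally minimal models under a `ℚ`-isogeny -/

section Lattice

open scoped MatrixGroups ModularForm
open CongruenceSubgroup Literature.NumberTheory.EllipticCurves.ModularForms _root_.PeriodPair

variable {W W' : WeierstrassCurve ℚ} [W.IsElliptic] [W'.IsElliptic] {N N' : ℕ} [NeZero N]
  [NeZero N']

/-- For an integer `z` not divisible by the prime `p`, `‖z‖_p = 1` (private helper). [folklore] -/
private theorem padicNorm_intCast_eq_one_of_not_dvd {p : ℕ} [Fact p.Prime] {z : ℤ} (h : ¬ (p : ℤ) ∣ z) :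
    ‖(z : ℚ_[p])‖ = 1 :=
  le_antisymm (Padic.norm_int_le_one z)
    (not_lt.mp fun hlt ↦ h (Padic.norm_intCast_lt_one_iff.mp hlt))

/-- For a natural number `n ∣ 2` and an odd prime `p`, `‖n‖_p = 1` (private helper). [folklore] -/
private theorem padicNorm_natCast_eq_one_of_dvd_two {p : ℕ} [Fact p.Prime] (hp2 : p ≠ 2) {n : ℕ}
    (h : n ∣ 2) : ‖(n : ℚ_[p])‖ = 1 := by
  have hpP : p.Prime := Fact.out
  rw [Padic.norm_natCast_eq_one_iff]
  rcases (Nat.dvd_prime Nat.prime_two).mp h with rfl | rfl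
  · exact Nat.coprime_one_right p
  · exact (Nat.coprime_primes hpP Nat.prime_two).mpr hp2

/-- The number of real components of `E(ℝ)` is `1` or `2`, so divides `2` (Cremona, *Algorithms*,
§3.7: two components iff `Δ > 0`; the tree's `numRealComponents` is defined by that case split).
[cite: CremonaAlgorithms1997, §3.7] -/
theorem numRealComponents_dvd_two (V : WeierstrassCurve ℝ) : V.numRealComponents ∣ 2 := by
  rcases lt_or_ge 0 V.Δ with h | h
  · rw [V.numRealComponents_of_Δ_pos h]
  · rw [V.numRealComponents_of_Δ_nonpos h]; exact one_dvd 2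

/-- **The Néron lattices of two globally minimal models under a `ℚ`-isogeny.** Let `ψ : W → W'` be
an isogeny over `ℚ` of degree `d` between GLOBALLY MINIMAL elliptic curves with modular
parametrisation data `D, D'` (used only for their Néron-type period pairs `Λ = Λ_W`, `Λ' = Λ_{W'}`,
real lattices with least positive real periods `Ω₀, Ω₀'`). Then there are integers `q, a, b` with
`q ∣ d`, `a · b = d` and `q · Ω₀ = a · Ω₀'`. Indeed `ψ` acts on the lattices as `z ↦ qz` with
`q ∈ ℚ`, `qΛ ⊆ Λ'`, `[Λ' : qΛ] = d` (Silverman, *AEC*, VI.4.1 (b), III.4.10 (c); tree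
`exists_rat_mulLeft_lattice_le_of_isogeny`); `q ∈ ℤ` and `d/q ∈ ℤ` by the integrality of Néron
scalings between globally minimal models (`integral_neronScaling_of_isGloballyMinimal_holds`, applied
to `qΛ ⊆ Λ'` and to `(d/q)Λ' ⊆ Λ`, the latter from `dΛ' ⊆ qΛ`); and `qΩ₀ ∈ Λ' ∩ ℝ = ℤΩ₀'`,
`(d/q)Ω₀' ∈ Λ ∩ ℝ = ℤΩ₀` give `qΩ₀ = aΩ₀'`, `(d/q)Ω₀' = bΩ₀` with `ab = d`. (The bookkeeping behind
Greenberg–Vatsal 2000, §3, Remark 3.4.) [cite: GreenbergVatsal2000, §3, Remark 3.4]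
[cite: SilvermanAEC2009, Thm. VI.4.1(b)] -/
theorem exists_int_mul_minRealPeriod_eq_of_isogeny [W.IsGloballyMinimal] [W'.IsGloballyMinimal]
    (D : ModularParametrizationData W N) (D' : ModularParametrizationData W' N')
    (ψ : Isogeny W W') :
    ∃ q a b : ℤ, q ≠ 0 ∧ q ∣ (ψ.degree : ℤ) ∧ a * b = ψ.degree ∧
      (q : ℝ) * D.L.minRealPeriod = a * D'.L.minRealPeriod := by
  obtain ⟨r, hr0, hle, hidx⟩ :=
    exists_rat_mulLeft_lattice_le_of_isogeny W W' D.isNeronLattice D'.isNeronLattice ψ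
  set d : ℕ := ψ.degree with hd
  have hr0' : (r : ℚ) ≠ 0 := by
    rintro rfl
    exact hr0 (by push_cast; rfl)
  -- `rΛ ⊆ Λ'`
  have hmem : ∀ z ∈ D.L.lattice, ((r : ℚ) : ℂ) * z ∈ D'.L.lattice := fun z hz ↦
    hle (mul_mem_mulLeft_lattice.mpr hz)
  -- `r ∈ ℤ`
  obtain ⟨q, hq⟩ := integral_neronScaling_of_isGloballyMinimal_holds W W' D.L D'.L D.isNeronLattice
    D'.isNeronLattice r hmem
  -- `dΛ' ⊆ rΛ`, i.e. `(d/r)Λ' ⊆ Λ`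
  have hdmem : ∀ z ∈ D'.L.lattice, ((d / r : ℚ) : ℂ) * z ∈ D.L.lattice := by
    intro z hz
    have h1 : d • z ∈ (D.L.mulLeft (r : ℂ) hr0).lattice := by
      have h2 := AddSubgroup.nsmul_relIndex_mem (D.L.mulLeft (r : ℂ) hr0).lattice.toAddSubgroup
        (K := D'.L.lattice.toAddSubgroup) (g := z) hz
      rw [hidx] at h2
      exact h2
    rw [mem_mulLeft_lattice, nsmul_eq_mul] at h1
    have e : ((d / r : ℚ) : ℂ) * z = ((r : ℚ) : ℂ)⁻¹ * ((d : ℂ) * z) := by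
      push_cast
      ring
    rw [e]
    exact h1
  obtain ⟨q', hq'⟩ := integral_neronScaling_of_isGloballyMinimal_holds W' W D'.L D.L
    D'.isNeronLattice D.isNeronLattice (d / r) hdmem
  have hqq' : q * q' = d := by
    have h : (q : ℚ) * q' = d := by
      rw [hq, hq']
      field_simp
    exact_mod_cast h
  -- the real sublattices
  have hR : D.L.IsReal := D.isReal_neronLattice
  have hR' : D'.L.IsReal := D'.isReal_neronLattice
  have hΩ := hR.minRealPeriod_mem_lattice
  have hΩ' := hR'.minRealPeriod_mem_lattice
  obtain ⟨a, ha⟩ := hR'.exists_eq_int_mul (t := (r : ℝ) * D.L.minRealPeriod) (by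
    have := hmem _ hΩ
    push_cast at this ⊢
    convert this using 2)
  obtain ⟨b, hb⟩ := hR.exists_eq_int_mul (t := ((d / r : ℚ) : ℝ) * D'.L.minRealPeriod) (by
    have := hdmem _ hΩ'
    push_cast at this ⊢
    convert this using 2)
  have hpos := hR.minRealPeriod_pos
  have hpos' := hR'.minRealPeriod_pos
  have hab : a * b = d := by
    -- multiply the two relations: `r Ω₀ · (d/r) Ω₀' = a b Ω₀' Ω₀`
    have h1 : ((r : ℝ) * D.L.minRealPeriod) * (((d / r : ℚ) : ℝ) * D'.L.minRealPeriod) =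
        (a * b : ℝ) * (D.L.minRealPeriod * D'.L.minRealPeriod) := by
      rw [ha, hb]; ring
    have hrR : ((r : ℚ) : ℝ) ≠ 0 := by exact_mod_cast hr0'
    have h2 : ((r : ℝ) * D.L.minRealPeriod) * (((d / r : ℚ) : ℝ) * D'.L.minRealPeriod) =
        (d : ℝ) * (D.L.minRealPeriod * D'.L.minRealPeriod) := by
      push_cast
      field_simp
    have h3 : ((a * b : ℤ) : ℝ) = d := by
      have := h1.symm.trans h2
      have hne : D.L.minRealPeriod * D'.L.minRealPeriod ≠ 0 := (mul_pos hpos hpos').ne'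
      exact_mod_cast mul_right_cancel₀ hne this
    exact_mod_cast h3
  refine ⟨q, a, b, ?_, ⟨q', hqq'.symm⟩, hab, ?_⟩
  · rintro rfl
    exact hr0' (by rw [← hq]; simp)
  · rw [← ha, ← hq]
    push_cast
    ring

/-! ### §3. The optimal curve: `Ω(E₀) = |c₀| · Ω⁺_f` up to a factor dividing `2` -/

/-- **The Néron period of the optimal curve against the period of the newform.** For a
lattice-optimal datum `D₀` (`Λ_{E₀} = c₀ Λ_f`: the optimal parametrisation read against the invariant
differential of the model, `c₀` its Manin constant) of ANY model `W₀`: `m · Ω(W₀) = |c₀| · Ω⁺_f` with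
`m ∣ 2`. The relation with some `m > 0` is the tree's `realPeriodRat_dvd_holds` (Edixhoven 1991, §1;
Cremona §2.8); `m ∣ 2` because `Ω₀ ∈ Λ_{E₀} = c₀Λ_f` is real, so `Ω₀/c₀ ∈ re Λ_f = ℤ · Ω⁺_f/2`,
while `Ω(W₀) = n Ω₀` with `n ∣ 2`. [cite: EdixhovenManin1991, §1]
[cite: CremonaAlgorithms1997, §2.8 (p. 26)] -/
theorem exists_dvd_two_mul_realPeriodRat_eq_of_latticeEq (D₀ : ModularParametrizationData W N)
    (hopt : ∀ z ∈ D₀.L.lattice, ∃ w ∈ periodLattice D₀.f, z = D₀.c * w) :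
    ∃ m : ℕ, m ∣ 2 ∧ (m : ℝ) * W.realPeriodRat = |(D₀.c : ℝ)| * plusPeriod D₀.f := by
  obtain ⟨m, hm0, hmeq⟩ := D₀.realPeriodRat_dvd_holds
  have hmeq' : (m : ℝ) * W.realPeriodRat = |(D₀.c : ℝ)| * plusPeriod D₀.f := hmeq
  refine ⟨m, ?_, hmeq'⟩
  have hR : D₀.L.IsReal := D₀.isReal_neronLattice
  have hc0 : D₀.c ≠ 0 := D₀.maninConstant_ne_zero_holds
  have hplus : 0 < plusPeriod D₀.f :=
    IsNewform0.plusPeriod_pos_holds D₀.isNewformOf.1 D₀.isNewformOf.coeffField_eq_bot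
  -- `Ω₀ = c₀ w`, `w ∈ Λ_f` real, so `Ω₀/c₀ = j Ω⁺_f/2`
  obtain ⟨w, hw, hΩw⟩ := hopt _ hR.minRealPeriod_mem_lattice
  have hwre : w.re ∈ ModularForms.realPeriods D₀.f := by
    rw [ModularForms.realPeriods, AddSubgroup.mem_map]
    exact ⟨w, hw, rfl⟩
  rw [realPeriods_eq_zmultiples_of_plusPeriod_pos D₀.f hplus, AddSubgroup.mem_zmultiples_iff] at hwre
  obtain ⟨j, hj⟩ := hwre
  have hw_eq : (D₀.L.minRealPeriod : ℝ) = D₀.c * w.re := by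
    have := congrArg Complex.re hΩw
    simpa using this
  -- `Ω(W₀) = n Ω₀`, `n ∣ 2`
  have hn := D₀.realPeriodRat_eq_numRealComponents_mul
  have hn2 := numRealComponents_dvd_two (W.baseChange ℝ)
  -- `m n j c₀ = 2 |c₀|`
  have key : ((m * (W.baseChange ℝ).numRealComponents : ℕ) : ℝ) * (j * D₀.c : ℤ) = 2 * |(D₀.c : ℝ)| := by
    have h1 : (m : ℝ) * ((W.baseChange ℝ).numRealComponents * (D₀.c * (j * (plusPeriod D₀.f / 2)))) =
        |(D₀.c : ℝ)| * plusPeriod D₀.f := by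
      rw [← hmeq', hn, hw_eq, ← hj, zsmul_eq_mul]
    have h2 : (((m * (W.baseChange ℝ).numRealComponents : ℕ) : ℝ) * (j * D₀.c : ℤ)) *
        plusPeriod D₀.f = (2 * |(D₀.c : ℝ)|) * plusPeriod D₀.f := by
      push_cast
      linear_combination (2 : ℝ) * h1
    exact mul_right_cancel₀ hplus.ne' h2
  -- hence `m ∣ 2` (take absolute values: `m n |j c₀| = 2 |c₀|`, `c₀ ≠ 0`)
  have key' : (m * (W.baseChange ℝ).numRealComponents : ℕ) * (j * D₀.c).natAbs = 2 * D₀.c.natAbs := by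
    have h := congrArg abs key
    rw [abs_mul, abs_mul, Nat.abs_cast, abs_two, abs_abs, ← Int.cast_abs, Int.abs_eq_natAbs,
      ← Int.cast_abs, Int.abs_eq_natAbs] at h
    exact_mod_cast h
  have hcpos : 0 < D₀.c.natAbs := Int.natAbs_pos.mpr hc0
  have : m ∣ 2 * D₀.c.natAbs / D₀.c.natAbs := by
    rw [← key', Int.natAbs_mul, show m * (W.baseChange ℝ).numRealComponents * (j.natAbs * D₀.c.natAbs)
      = (m * ((W.baseChange ℝ).numRealComponents * j.natAbs)) * D₀.c.natAbs by ring,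
      Nat.mul_div_cancel _ hcpos]
    exact Dvd.intro _ rfl
  rwa [Nat.mul_div_cancel _ hcpos] at this

/-! ### §4. Assembly: `Ω(W) = u · Ω⁺_f` with `‖u‖_p = 1` -/

/-- **Greenberg–Vatsal 2000, §3, Remark 3.4 / Skinner–Urban 2014, §3.6.7 (p. 45), PROVED modulo
the Manin constant of the optimal curve.** Let `W/ℚ` be a globally minimal elliptic curve, `p` an
ODD prime with `E[p]` irreducible, `f ∈ S₂(Γ₀(N))` the newform of `W`, and assume (`hc`) that the
Manin constant `c₀` of the lattice-optimal datum at level `N` (on a globally minimal model `W₀` of the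
strong Weil curve `E_f`, `Λ_{W₀} = c₀Λ_f`) is prime to `p`. Then `Ω(W) = u · Ω⁺_f` with `u ∈ ℚ`,
`‖u‖_p = 1`. Proof: a datum `D` of `W` exists (`nonempty_modularParametrizationData_of_isNewformOf`,
from `IsNewformOf W f` alone), hence the optimal datum `D₀` on a globally minimal `W₀ ~ W`
(`exists_optimalDatum_of_edixhoven` with Edixhoven's Prop. 2 = tree theorem
`edixhoven_int_of_neronLattice_eq_smul_periodLattice_holds`); an isogeny `ψ : W → W₀` of degree `d`
prime to `p` (`exists_isogeny_not_dvd_degree_of_irreducible`); `qΩ₀ = aΩ₀'`, `q ∣ d`, `ab = d`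
(`exists_int_mul_minRealPeriod_eq_of_isogeny`); `mΩ(W₀) = |c₀|Ω⁺_f`, `m ∣ 2`
(`exists_dvd_two_mul_realPeriodRat_eq_of_latticeEq`); `Ω = nΩ₀`, `Ω(W₀) = n₀Ω₀'` with
`n, n₀ ∣ 2`; so `u = n a |c₀| / (q m n₀)`, a `p`-adic unit for odd `p`.
[cite: GreenbergVatsal2000, §3, Remark 3.4] [cite: SkinnerUrban2014, §3.6.7 (p. 45)]
[cite: EdixhovenManin1991, Prop. 2 and §1] -/
theorem exists_unit_mul_plusPeriod_of_irreducible (W : WeierstrassCurve ℚ) [W.IsElliptic]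
    [W.IsGloballyMinimal] (p : ℕ) [Fact p.Prime] (hp2 : p ≠ 2)
    (hirr : W.HasIrreducibleModPGaloisRep p) (f : CuspForm (Gamma0 N) 2) (hf : IsNewformOf W f)
    (hc : ∀ (W₀ : WeierstrassCurve ℚ) [W₀.IsElliptic] [W₀.IsGloballyMinimal]
      (D₀ : ModularParametrizationData W₀ N), D₀.f = f →
      (∀ z ∈ D₀.L.lattice, ∃ w ∈ periodLattice D₀.f, z = D₀.c * w) → ¬ (p : ℤ) ∣ D₀.maninConstant) :
    ∃ u : ℚ, ‖(u : ℚ_[p])‖ = 1 ∧ W.realPeriodRat = u * plusPeriod f := by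
  have hpP : p.Prime := Fact.out
  -- a datum of `W` at level `N`, with newform `f`
  obtain ⟨D⟩ := Literature.NumberTheory.Automorphic.nonempty_modularParametrizationData_of_isNewformOf hf
  have hDf : D.f = f := D.isNewformOf.unique hf
  subst hDf
  -- the optimal datum on a globally minimal model of the strong Weil curve
  obtain ⟨W₀, hW₀, hW₀', D₀, hf₀, hiso, hopt, -⟩ :=
    D.exists_optimalDatum_of_edixhoven
      (fun hf' hL' q hq hq' ↦ edixhoven_int_of_neronLattice_eq_smul_periodLattice_holds hf' hL' q hq hq')
  have hc₀ : ¬ (p : ℤ) ∣ D₀.c := hc W₀ D₀ hf₀ hopt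
  -- an isogeny `W → W₀` of degree prime to `p`
  obtain ⟨ψ, hψ⟩ := exists_isogeny_not_dvd_degree_of_irreducible (W := W) (W' := W₀)
    (Nat.cast_ne_zero.mpr hpP.ne_zero) hirr hiso
  -- the lattice step and the optimal-curve step
  obtain ⟨q, a, b, hq0, hqd, hab, hqa⟩ := exists_int_mul_minRealPeriod_eq_of_isogeny D D₀ ψ
  obtain ⟨m, hm2, hm⟩ := exists_dvd_two_mul_realPeriodRat_eq_of_latticeEq D₀ hopt
  have hn := D.realPeriodRat_eq_numRealComponents_mul
  have hn₀ := D₀.realPeriodRat_eq_numRealComponents_mul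
  set n := (W.baseChange ℝ).numRealComponents with hn_def
  set n₀ := (W₀.baseChange ℝ).numRealComponents with hn₀_def
  have hn2 : n ∣ 2 := numRealComponents_dvd_two _
  have hn₀2 : n₀ ∣ 2 := numRealComponents_dvd_two _
  -- non-vanishing
  have hm0 : (m : ℝ) ≠ 0 := by
    have : m ≠ 0 := fun h ↦ by rw [h] at hm2; exact absurd hm2 (by decide)
    exact_mod_cast this
  have hn₀0 : (n₀ : ℝ) ≠ 0 := by exact_mod_cast (numRealComponents_pos _).ne'
  have hq0' : (q : ℝ) ≠ 0 := by exact_mod_cast hq0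
  -- not divisible by `p`
  have hpa : ¬ (p : ℤ) ∣ a := fun h ↦ hψ (Int.natCast_dvd_natCast.mp (hab ▸ h.mul_right b))
  have hpq : ¬ (p : ℤ) ∣ q := fun h ↦ hψ (Int.natCast_dvd_natCast.mp (h.trans hqd))
  have hpc : ¬ (p : ℤ) ∣ |D₀.c| := fun h ↦ hc₀ ((dvd_abs _ _).mp h)
  refine ⟨((n : ℚ) * a * (|D₀.c| : ℤ)) / ((q : ℚ) * m * n₀), ?_, ?_⟩
  · have e : ((((n : ℚ) * a * (|D₀.c| : ℤ)) / ((q : ℚ) * m * n₀) : ℚ) : ℚ_[p]) =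
        ((n : ℚ_[p]) * (a : ℚ_[p]) * ((|D₀.c| : ℤ) : ℚ_[p])) /
          ((q : ℚ_[p]) * (m : ℚ_[p]) * (n₀ : ℚ_[p])) := by
      simp only [Rat.cast_div, Rat.cast_mul, Rat.cast_natCast, Rat.cast_intCast]
    rw [e, norm_div, norm_mul, norm_mul, norm_mul, norm_mul,
      padicNorm_natCast_eq_one_of_dvd_two hp2 hn2, padicNorm_intCast_eq_one_of_not_dvd hpa,
      padicNorm_intCast_eq_one_of_not_dvd hpc, padicNorm_intCast_eq_one_of_not_dvd hpq,
      padicNorm_natCast_eq_one_of_dvd_two hp2 hm2, padicNorm_natCast_eq_one_of_dvd_two hp2 hn₀2]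
    norm_num
  · -- `Ω(W) = n Ω₀ = n (a/q) Ω₀' = n a |c₀| Ω⁺_f / (q m n₀)`
    rw [hf₀, ← Int.cast_abs] at hm
    have h1 : W.realPeriodRat * ((q : ℝ) * m * n₀) =
        ((n : ℝ) * a * ((|D₀.c| : ℤ) : ℝ)) * plusPeriod D.f := by
      calc W.realPeriodRat * ((q : ℝ) * m * n₀)
          = n * ((q : ℝ) * D.L.minRealPeriod) * (m * n₀) := by rw [hn]; ring
        _ = n * (a * D₀.L.minRealPeriod) * (m * n₀) := by rw [hqa]
        _ = n * a * (m * (n₀ * D₀.L.minRealPeriod)) := by ring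
        _ = n * a * (m * W₀.realPeriodRat) := by rw [hn₀]
        _ = ((n : ℝ) * a * ((|D₀.c| : ℤ) : ℝ)) * plusPeriod D.f := by rw [hm]; ring
    have hden : ((q : ℝ) * m * n₀) ≠ 0 := mul_ne_zero (mul_ne_zero hq0' hm0) hn₀0
    have hcast : ((((n : ℚ) * a * (|D₀.c| : ℤ)) / ((q : ℚ) * m * n₀) : ℚ) : ℝ) =
        ((n : ℝ) * a * ((|D₀.c| : ℤ) : ℝ)) / ((q : ℝ) * m * n₀) := by
      simp only [Rat.cast_div, Rat.cast_mul, Rat.cast_natCast, Rat.cast_intCast]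
    rw [hcast, div_mul_eq_mul_div, eq_div_iff hden]
    exact h1

end Lattice

/-! ### §5. The three named period-unit facts of `ModularCurvePeriodRatio.lean`, from the Manin
constant of the optimal curve (Mazur 1978, Cor. 4.1; Abbes–Ullmo 1996, Thm. A) -/

section NamedFacts

open scoped MatrixGroups ModularForm
open CongruenceSubgroup Literature.NumberTheory.EllipticCurves.ModularForms NumberField
  IsDedekindDomain Rat.HeightOneSpectrum

/-- `a_p(E) = ±1 ≠ 0` at a prime of multiplicative reduction (Silverman, *AEC*, §C.16: the local
factor is `1 ∓ T`; tree lemmas `LFunction_apply_primesEquiv_of_hasSplitMultiplicativeReductionAt` /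
`…_of_hasMultiplicativeReductionAt_of_not_split` at the place of `𝓞 ℚ` over `p`).
[cite: SilvermanAEC2009, §C.16 (definition of L_v(T))] -/
theorem LFunction_apply_ne_zero_of_hasMultiplicativeReductionAtPrime (W : WeierstrassCurve ℚ)
    [W.IsElliptic] (p : ℕ) [Fact p.Prime] (h : W.HasMultiplicativeReductionAtPrime p) :
    W.LFunction p ≠ 0 := by
  have hpP : p.Prime := Fact.out
  obtain ⟨v, hv⟩ : ∃ v : HeightOneSpectrum (𝓞 ℚ), ((primesEquiv v : ℕ)) = p :=
    ⟨primesEquiv.symm ⟨p, hpP⟩, by rw [Equiv.apply_symm_apply]⟩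
  subst hv
  have hmult : W.HasMultiplicativeReductionAt v :=
    (W.hasMultiplicativeReductionAtPrime_iff_hasMultiplicativeReductionAt_ringOfIntegers v).mp h
  by_cases hs : W.HasSplitMultiplicativeReductionAt v
  · rw [W.LFunction_apply_primesEquiv_of_hasSplitMultiplicativeReductionAt hs]
    exact one_ne_zero
  · rw [W.LFunction_apply_primesEquiv_of_hasMultiplicativeReductionAt_of_not_split hmult hs]
    norm_num

/-- **The period unit at an odd prime `p` with `p² ∤ N` and `E[p]` irreducible, from Mazur 1978,
Cor. 4.1** (the Manin constant of the `X₀(N)`-optimal curve is prime to every odd `p` with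
`p² ∤ N`; tree named fact `mazur_not_dvd_maninConstant_of_odd`, lattice form): for a globally
minimal elliptic `W/ℚ` with newform `f ∈ S₂(Γ₀(N))`, `Ω(W) = u · Ω⁺_f` with `u ∈ ℚ`, `‖u‖_p = 1`
(`exists_unit_mul_plusPeriod_of_irreducible`). This covers good AND multiplicative odd `p`.
[cite: Mazur1978, Cor. 4.1] [cite: GreenbergVatsal2000, §3, Remark 3.4]
[cite: SkinnerUrban2014, §3.6.7 (p. 45)] -/
theorem exists_unit_mul_plusPeriod_of_irreducible_of_mazur
    (hM : mazur_not_dvd_maninConstant_of_odd) (W : WeierstrassCurve ℚ) [W.IsElliptic]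
    [W.IsGloballyMinimal] (p : ℕ) [Fact p.Prime] (hp2 : p ≠ 2)
    (hirr : W.HasIrreducibleModPGaloisRep p) {N : ℕ} [NeZero N] (f : CuspForm (Gamma0 N) 2)
    (hf : IsNewformOf W f) (hpN : ¬ p ^ 2 ∣ N) :
    ∃ u : ℚ, ‖(u : ℚ_[p])‖ = 1 ∧ W.realPeriodRat = u * plusPeriod f :=
  exists_unit_mul_plusPeriod_of_irreducible W p hp2 hirr f hf
    fun W₀ _ _ D₀ _ hopt ↦ hM W₀ D₀ hopt p Fact.out hp2 hpN

/-- **The period unit at a GOOD prime `p` (any `p`, `p ∤ N`) with `E[p]` irreducible and `p` odd,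
from Abbes–Ullmo 1996, Thm. A** (the Manin constant of the optimal curve is prime to every
`p ∤ N`; tree named fact `abbesUllmo_not_dvd_maninConstant_of_not_dvd_level`).
[cite: AbbesUllmo1996, Thm. A] [cite: GreenbergVatsal2000, §3, Remark 3.4] -/
theorem exists_unit_mul_plusPeriod_of_irreducible_of_abbesUllmo
    (hAU : abbesUllmo_not_dvd_maninConstant_of_not_dvd_level) (W : WeierstrassCurve ℚ)
    [W.IsElliptic] [W.IsGloballyMinimal] (p : ℕ) [Fact p.Prime] (hp2 : p ≠ 2)
    (hirr : W.HasIrreducibleModPGaloisRep p) {N : ℕ} [NeZero N] (f : CuspForm (Gamma0 N) 2)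
    (hf : IsNewformOf W f) (hpN : ¬ p ∣ N) :
    ∃ u : ℚ, ‖(u : ℚ_[p])‖ = 1 ∧ W.realPeriodRat = u * plusPeriod f :=
  exists_unit_mul_plusPeriod_of_irreducible W p hp2 hirr f hf
    fun W₀ _ _ D₀ _ hopt ↦ hAU W₀ D₀ hopt p Fact.out hpN

/-- At a prime of good reduction the level of the newform is prime to `p`: `p ∣ N ↔ p ∣ N_W`
(`IsNewformOf.dvd_level_iff_dvd_conductorNorm`, Atkin–Lehner) and `p ∣ N_W ↔` bad reduction at `p`
(`dvd_conductorNorm_iff_not_hasGoodReductionAtPrime`). [cite: DiamondShurman2005, §8.3 and Thm. 8.8.1] -/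
theorem not_dvd_level_of_hasGoodReductionAtPrime {W : WeierstrassCurve ℚ} [W.IsElliptic] {p : ℕ}
    [Fact p.Prime] (hgood : W.HasGoodReductionAtPrime p) {N : ℕ} [NeZero N]
    {f : CuspForm (Gamma0 N) 2} (hf : IsNewformOf W f) : ¬ p ∣ N := fun h ↦
  (W.dvd_conductorNorm_iff_not_hasGoodReductionAtPrime p).mp
    ((hf.dvd_level_iff_dvd_conductorNorm Fact.out).mp h) hgood

/-- At a prime of multiplicative reduction `p² ∤ N` for the level `N` of the newform: `a_p(E) = ±1 ≠ 0`
(`LFunction_apply_ne_zero_of_hasMultiplicativeReductionAtPrime`) while `p² ∣ N` would force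
`a_p(f) = 0` (Atkin–Lehner 1970, Thm. 3; `IsNewformOf.not_sq_dvd_level_of_lFunction_ne_zero`).
[cite: AtkinLehner1970, Thm. 3] -/
theorem not_sq_dvd_level_of_hasMultiplicativeReductionAtPrime {W : WeierstrassCurve ℚ} [W.IsElliptic]
    {p : ℕ} [Fact p.Prime] (hmult : W.HasMultiplicativeReductionAtPrime p) {N : ℕ} [NeZero N]
    {f : CuspForm (Gamma0 N) 2} (hf : IsNewformOf W f) : ¬ p ^ 2 ∣ N :=
  hf.not_sq_dvd_level_of_lFunction_ne_zero Fact.out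
    (LFunction_apply_ne_zero_of_hasMultiplicativeReductionAtPrime W p hmult)

/-- **`realPeriodRat_eq_unit_mul_plusPeriod` (good `p ≥ 5`, `E[p]` irreducible) from Mazur 1978,
Cor. 4.1 alone** — the named fact of `ModularCurvePeriodRatio.lean` (there sourced to Greenberg–Vatsal
2000, §3, Remark 3.4, a remark printed without proof) is a THEOREM over the tree granted the
lattice-form Manin-constant fact `mazur_not_dvd_maninConstant_of_odd`: `p ∤ N_W` (good reduction),
so `p ∤ N` and `p² ∤ N`. [cite: Mazur1978, Cor. 4.1] [cite: GreenbergVatsal2000, §3, Remark 3.4]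
[cite: SkinnerUrban2014, §3.6.7 (p. 45)] -/
theorem realPeriodRat_eq_unit_mul_plusPeriod_of_mazur (hM : mazur_not_dvd_maninConstant_of_odd) :
    realPeriodRat_eq_unit_mul_plusPeriod := by
  intro W _ _ p _ h5 hgood hirr N _ f hf
  have hp2 : p ≠ 2 := by omega
  exact exists_unit_mul_plusPeriod_of_irreducible_of_mazur hM W p hp2 hirr f hf fun h ↦
    not_dvd_level_of_hasGoodReductionAtPrime hgood hf (dvd_trans (dvd_pow_self p two_ne_zero) h)

/-- **`realPeriodRat_eq_unit_mul_plusPeriod_three` (good `p = 3`, `E[3]` irreducible) from Mazur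
1978, Cor. 4.1 alone.** [cite: Mazur1978, Cor. 4.1] [cite: GreenbergVatsal2000, §3, Remark 3.4] -/
theorem realPeriodRat_eq_unit_mul_plusPeriod_three_of_mazur
    (hM : mazur_not_dvd_maninConstant_of_odd) : realPeriodRat_eq_unit_mul_plusPeriod_three := by
  intro W _ _ hgood hirr N _ f hf
  exact exists_unit_mul_plusPeriod_of_irreducible_of_mazur hM W 3 (by decide) hirr f hf fun h ↦
    not_dvd_level_of_hasGoodReductionAtPrime hgood hf (dvd_trans (dvd_pow_self 3 two_ne_zero) h)

/-- **`realPeriodRat_eq_unit_mul_plusPeriod_of_multiplicative` (multiplicative `p ≥ 5`, `E[p]`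
irreducible) from Mazur 1978, Cor. 4.1 alone**: at a multiplicative prime `p ∥ N_W` and `p² ∤ N`
(`not_sq_dvd_level_of_hasMultiplicativeReductionAtPrime`), which is all Mazur's corollary needs.
[cite: Mazur1978, Cor. 4.1] [cite: GreenbergVatsal2000, §3, Remark 3.4] -/
theorem realPeriodRat_eq_unit_mul_plusPeriod_of_multiplicative_of_mazur
    (hM : mazur_not_dvd_maninConstant_of_odd) :
    realPeriodRat_eq_unit_mul_plusPeriod_of_multiplicative := by
  intro W _ _ p _ h5 hmult hirr N _ f hf
  have hp2 : p ≠ 2 := by omega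
  exact exists_unit_mul_plusPeriod_of_irreducible_of_mazur hM W p hp2 hirr f hf
    (not_sq_dvd_level_of_hasMultiplicativeReductionAtPrime hmult hf)

/-- **`realPeriodRat_eq_unit_mul_plusPeriod` from Abbes–Ullmo 1996, Thm. A alone** (alternative
source for the good-reduction case). [cite: AbbesUllmo1996, Thm. A] [cite: GreenbergVatsal2000, §3, Remark 3.4] -/
theorem realPeriodRat_eq_unit_mul_plusPeriod_of_abbesUllmo
    (hAU : abbesUllmo_not_dvd_maninConstant_of_not_dvd_level) :
    realPeriodRat_eq_unit_mul_plusPeriod := by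
  intro W _ _ p _ h5 hgood hirr N _ f hf
  have hp2 : p ≠ 2 := by omega
  exact exists_unit_mul_plusPeriod_of_irreducible_of_abbesUllmo hAU W p hp2 hirr f hf
    (not_dvd_level_of_hasGoodReductionAtPrime hgood hf)

/-- **`realPeriodRat_eq_unit_mul_plusPeriod_three` from Abbes–Ullmo 1996, Thm. A alone.**
[cite: AbbesUllmo1996, Thm. A] [cite: GreenbergVatsal2000, §3, Remark 3.4] -/
theorem realPeriodRat_eq_unit_mul_plusPeriod_three_of_abbesUllmo
    (hAU : abbesUllmo_not_dvd_maninConstant_of_not_dvd_level) :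
    realPeriodRat_eq_unit_mul_plusPeriod_three := by
  intro W _ _ hgood hirr N _ f hf
  exact exists_unit_mul_plusPeriod_of_irreducible_of_abbesUllmo hAU W 3 (by decide) hirr f hf
    (not_dvd_level_of_hasGoodReductionAtPrime hgood hf)

/-- **The inline period-unit binder `hϖ` of the cell's rank-`0` theorems, from Mazur 1978, Cor. 4.1
alone**: `Rank1Residual/PeriodUnitProofs.lean` derives `hϖ` from the two named facts
`realPeriodRat_eq_unit_mul_plusPeriod[_three]`; both follow from `mazur_not_dvd_maninConstant_of_odd`,
so at every odd good prime with `E[p]` irreducible `ord_p(Ω⁺_f/Ω_E) = 0` granted that single fact.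
[cite: Mazur1978, Cor. 4.1] [cite: GreenbergVatsal2000, §3, Remark 3.4] -/
theorem periodUnit_facts_of_mazur (hM : mazur_not_dvd_maninConstant_of_odd) :
    realPeriodRat_eq_unit_mul_plusPeriod ∧ realPeriodRat_eq_unit_mul_plusPeriod_three ∧
      realPeriodRat_eq_unit_mul_plusPeriod_of_multiplicative :=
  ⟨realPeriodRat_eq_unit_mul_plusPeriod_of_mazur hM,
    realPeriodRat_eq_unit_mul_plusPeriod_three_of_mazur hM,
    realPeriodRat_eq_unit_mul_plusPeriod_of_multiplicative_of_mazur hM⟩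

/-- **The inline period-unit binder `hϖ` of the cell's rank-`0` theorems VERBATIM, from Mazur
1978, Cor. 4.1 alone**: the hypothesis `hϖ` of `padicValRat_bsd_rank_zero_of_facts_cyc`
(`LeadingTermPPartProofs`) / `periodUnit_of_realPeriodRat_eq_unit_mul_plusPeriod`
(`Rank1Residual/PeriodUnitProofs`) — at every odd good prime `p` with `E[p]` irreducible and every
`ϖ ∈ ℚ` with `ϖ · Ω(W) = Ω⁺_f` (newform at level `N_E`), `ord_p ϖ = 0`.
[cite: Mazur1978, Cor. 4.1] [cite: GreenbergVatsal2000, §3, Remark 3.4]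
[cite: SkinnerUrban2014, §3.6.7 (p. 45)] -/
theorem periodUnit_of_mazur (hM : mazur_not_dvd_maninConstant_of_odd) :
    ∀ (W : WeierstrassCurve ℚ) [W.IsElliptic] [W.IsGloballyMinimal] (p : ℕ) [Fact p.Prime],
      p ≠ 2 → W.HasGoodReductionAtPrime p → W.HasIrreducibleModPGaloisRep p →
      ∀ [NeZero (W.conductorNorm ℤ)] (f : CuspForm (Gamma0 (W.conductorNorm ℤ)) 2),
        IsNewformOf W f →
      ∀ ϖ : ℚ, (ϖ : ℝ) * W.realPeriodRat = plusPeriod f → padicValRat p ϖ = 0 :=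
  Rank1Residual.periodUnit_of_realPeriodRat_eq_unit_mul_plusPeriod
    (realPeriodRat_eq_unit_mul_plusPeriod_of_mazur hM)
    (realPeriodRat_eq_unit_mul_plusPeriod_three_of_mazur hM)

end NamedFacts


end Literature.NumberTheory.EllipticCurves.SkinnerUrban2014

end
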